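import Mathlib

/-!
# Weighted initial form — stub `stub_initialForm` of line `refutation-cuspidal-edge` (crux stmt-ResolutionOfSingularities-18182, route ShadowGame)

For positive integer weights `wt : Fin 3 → ℕ` we construct the weighted initial form `ι f` of a
power series `f ∈ κ⟦x,y,z⟧`: its lowest weighted-homogeneous component, as a POLYNOMIAL (the set
of exponents of a fixed weight is finite because all weights are positive,
`Finsupp.finite_of_nat_weight_eq`).  Concretely `ι f := truncFinset κ S f` with `S` the exponents
of weight `(weightedOrder wt f).toNat`; its coercion to `κ⟦x,y,z⟧` is
`weightedHomogeneousComponent wt _ f`, whence `ι f = 0 ↔ f = 0`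
(`weightedHomogeneousComponent_of_weightedOrder`), multiplicativity (`weightedOrder_mul` in the
domain `κ⟦x,y,z⟧` and `weightedHomogeneousComponent_mul_of_le_weightedOrder`, then injectivity of
the coercion), and the coefficient description (`weightedOrder_eq_nat`).
-/

noncomputable section

set_option linter.dupNamespace false

namespace Summit.ResolutionOfSingularities.ResolutionOfSingularities.Theorems.ShadowGameWinR.Negative

open MvPowerSeries

/-- Coefficients of the truncation of a power series to the (finite) set of exponents of a fixed
weight `n` (all weights non-zero): the coefficients of `f` in weight `n`, and `0` elsewhere.
[folklore] -/
theorem coeff_truncFinset_weight_eq {σ : Type*} [Finite σ] {R : Type*} [CommSemiring R]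
    (w : σ → ℕ) (hw : ∀ i, w i ≠ 0) (n : ℕ) (f : MvPowerSeries σ R) (d : σ →₀ ℕ) :
    MvPolynomial.coeff d (truncFinset R (Finsupp.finite_of_nat_weight_eq w hw n).toFinset f) =
      if Finsupp.weight w d = n then coeff d f else 0 := by
  split_ifs with h
  · exact coeff_truncFinset_of_mem f (by simpa using h)
  · exact coeff_truncFinset_eq_zero f (by simpa using h)

/-- The truncation of `f` to the exponents of weight `n`, coerced back to power series, is the
weighted homogeneous component of `f` of weight `n`. [folklore] -/
theorem coe_truncFinset_weight_eq {σ : Type*} [Finite σ] {R : Type*} [CommSemiring R]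
    (w : σ → ℕ) (hw : ∀ i, w i ≠ 0) (n : ℕ) (f : MvPowerSeries σ R) :
    ((truncFinset R (Finsupp.finite_of_nat_weight_eq w hw n).toFinset f : MvPolynomial σ R) :
      MvPowerSeries σ R) = weightedHomogeneousComponent w n f := by
  ext d
  rw [MvPolynomial.coeff_coe, coeff_truncFinset_weight_eq w hw, coeff_weightedHomogeneousComponent]

/-- Weighted initial form for positive weights on `κ⟦x,y,z⟧`: there is a map `ι` to polynomials
with `ι f = 0 ↔ f = 0`, `ι (f * g) = ι f * ι g`, and, for `f ≠ 0`, `ι f` collects exactly the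
coefficients of `f` of lowest weight `N` (below which `f` has no coefficients). [folklore] -/
theorem stub_initialForm (κ : Type) [Field κ] (wt : Fin 3 → ℕ) (hwt : ∀ i, 0 < wt i) :
    ∃ ι : MvPowerSeries (Fin 3) κ → MvPolynomial (Fin 3) κ,
      (∀ f, ι f = 0 ↔ f = 0) ∧
      (∀ f g, ι (f * g) = ι f * ι g) ∧
      (∀ f : MvPowerSeries (Fin 3) κ, f ≠ 0 → ∃ N : ℕ,
        (∀ d, Finsupp.weight wt d < N → coeff d f = 0) ∧
        (∃ d, Finsupp.weight wt d = N ∧ coeff d f ≠ 0) ∧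
        (∀ d, MvPolynomial.coeff d (ι f) = if Finsupp.weight wt d = N then coeff d f else 0)) := by
  have hw : ∀ i, wt i ≠ 0 := fun i => (hwt i).ne'
  -- a non-zero series has finite weighted order
  have hN : ∀ f : MvPowerSeries (Fin 3) κ, f ≠ 0 →
      (((weightedOrder wt f).toNat : ℕ) : ℕ∞) = weightedOrder wt f :=
    fun f hf => (ne_zero_iff_weightedOrder_finite wt).mp hf
  have htop : ∀ f : MvPowerSeries (Fin 3) κ, f ≠ 0 → weightedOrder wt f ≠ ⊤ :=
    fun f hf h => hf ((weightedOrder_eq_top_iff wt).mp h)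
  -- the initial form: truncation to the exponents of weight `weightedOrder`
  obtain ⟨ι, hι⟩ : ∃ ι : MvPowerSeries (Fin 3) κ → MvPolynomial (Fin 3) κ, ∀ f, ι f =
      truncFinset κ (Finsupp.finite_of_nat_weight_eq wt hw (weightedOrder wt f).toNat).toFinset f :=
    ⟨_, fun f => rfl⟩
  have hcoe : ∀ f : MvPowerSeries (Fin 3) κ, ((ι f : MvPolynomial (Fin 3) κ) :
      MvPowerSeries (Fin 3) κ) = weightedHomogeneousComponent wt (weightedOrder wt f).toNat f :=
    fun f => by rw [hι, coe_truncFinset_weight_eq wt hw]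
  have hzero : ι 0 = 0 := by rw [hι, map_zero]
  refine ⟨ι, fun f => ⟨fun h => ?_, fun h => by rw [h, hzero]⟩, fun f g => ?_, fun f hf => ?_⟩
  · -- `ι f = 0 → f = 0`: the component of weight `weightedOrder f` of a non-zero `f` is non-zero
    by_contra hf
    exact weightedHomogeneousComponent_of_weightedOrder (hN f hf)
      (by rw [← hcoe, h, MvPolynomial.coe_zero])
  · -- multiplicativity
    by_cases hf : f = 0
    · rw [hf, zero_mul, hzero, zero_mul]
    by_cases hg : g = 0
    · rw [hg, mul_zero, hzero, mul_zero]
    rw [← MvPolynomial.coe_inj, MvPolynomial.coe_mul, hcoe, hcoe, hcoe, weightedOrder_mul,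
      ENat.toNat_add (htop f hf) (htop g hg)]
    exact weightedHomogeneousComponent_mul_of_le_weightedOrder (hN f hf).le (hN g hg).le
  · -- coefficient description, `N = weightedOrder f`
    obtain ⟨⟨d, hd, hdN⟩, hlt⟩ := (weightedOrder_eq_nat wt).mp (hN f hf).symm
    refine ⟨(weightedOrder wt f).toNat, hlt, ⟨d, hdN, hd⟩, fun e => ?_⟩
    rw [hι, coeff_truncFinset_weight_eq wt hw]

end Summit.ResolutionOfSingularities.ResolutionOfSingularities.Theorems.ShadowGameWinR.Negative

end
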